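import Summits.HodgeConjecture.HodgeConjecture.Theorems.F0P3cStCharTSJacLen1      -- ★ `n1_line_data` (Keys N1 re-assembled in the theorem world; LH6-p03)
import Literature.NumberTheory.Automorphic.JacquetRayShellAllLevels               -- ★ (this seat) F1-G generic ED. 2: `Representation.smoothTrace_indicator_shell_eq_ite_of_normalizedTwoStep`
import Literature.NumberTheory.Automorphic.SmoothInductionAdmissibleOfCocompact   -- ★ `isAdmissible_cmPrincipalSeries_of_iwasawa`
import Literature.NumberTheory.Automorphic.UnitaryGroupCMLocalIwasawa             -- ★ `exists_borel_mul_mem_cmLocalIntegralLevel` (Iwasawa `G = B·K_v`)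
import Literature.NumberTheory.Automorphic.CMBorelUnipotentIndexModulus           -- ★ `isClosed_cmBorelTriple_N`
import Literature.NumberTheory.Automorphic.CMBorelWeylTorusConjugate              -- ★ `cmTorusCharPair_weylConj`, `weylConj_mem_cmTorus` (`χ(ʷt) = (wχ)(t)`) (ED. 2)
import HarnessLib

/-!
# F0 · P3c · line LH6 «StCharTS» — road (D) «DEEP-FL», brick F1-G COROLLARY «R2d-ALL-LEVELS FOR `i_G(χ)`»: the character of the principal series
# `i_G(χ₁, χ₂)` of `U(Φ₃)(L⁺_v)` (non-split `v`) on EVERY shell `K_n b K_n` of an Iwahori datum: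
# `tr i_G(χ)(𝟙_{K_n b K_n}) = μ(K_n)·#R·(𝟙[χ|_{K_n ∩ T} = 1]·δ_B^{1/2}(b)·(χ(b) + (wχ)(b)))`

Cell `pub/hodgecm-mathlib`, crux H413 = `stmt-HodgeConjecture-24833` (lane `--supports … --as helper`), route HCCMUnconditional; seat LH10-p02 (g2) (free hand on line
LH6's road (D); desk F0P3b-plan (g23) DEAL «F1-G» 2026-09-02T04:43:57Z; road owner LH6-p04 (g2) spec `F0/P3b/LH6-p04/g2/F1G.signature-spec.txt` 15b282cbdfa4785b,
COROLLARY clause).  THEOREMS ONLY, sorry-free; no definition ∕ instance ∕ notation ∕ named fact.  HONEST LABEL: HC_CM is proved only modulo the 7 printed citations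
(2 remaining: hLiu418 = stmt-HodgeConjecture-24832, h413 = stmt-HodgeConjecture-24833) until rung 0 closes; count-neutral in-house structure — the input of D3-ii
«SHELL-ORBITAL» (the canonical split-torus orbital integrals of the shell indicators, read off the orbital form of `tr i_G(χ)` ★ `CMPrincipalSeriesTraceOrbitalForm`
and F3 ★ `CharacterIntegralsSeparate`).

THE MATHEMATICS ([Casselman1977, Thm. 5.2]; [Casselman1995, Lemma 7.1.1 (a), Thm. 3.3.3, Prop. 4.1.6]; [Rogawski1990, §12.2 pp. 173–174, §12.7 p. 193]).
`G = U(Φ₃)(L⁺_v)` at a finite place `v` of `L⁺` NON-SPLIT in `L`, `B = TN` (★ `cmBorelTriple L 3 v`), `ρ = i_G(χ)` the principal series of the continuous character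
`χ = (χ₁, χ₂)` of `T` (★ `cmPrincipalSeries`, ★ `cmTorusCharPair`), admissible (★ Iwasawa).  By ★ Keys N1 (`n1_line_data`) the normalised Jacquet module `r_B(ρ)` is
`2`-dimensional with a `T`-line of character `wχ` (★ `cmWeylTorusCharPair`) and quotient character `χ`; un-normalising (★ `normalizedJacquet_apply`), `T` acts on
`V_N = ρ_N` by `θ₁ = δ_B^{1/2}·wχ` on the line and `θ₂ = δ_B^{1/2}·χ` on the quotient, so `tr ρ_N(m) = θ₁(m) + θ₂(m)` (trace along an invariant line).  Since `δ_B^{1/2}`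
is trivial on the compact `K_n ∩ T` (`B` closed: ★ `rootDeltaChar_eq_one_of_mem_of_isClosed_of_isCompact`), `θ₁|_{K_n ∩ T} = 1 ↔ (wχ)|_{K_n ∩ T} = 1` and `θ₂|_{K_n ∩ T} = 1 ↔ χ|_{K_n ∩ T} = 1`;
under the hypothesis `hiff` «`χ|_{K_n ∩ T} = 1 ↔ (wχ)|_{K_n ∩ T} = 1`» (true for every datum whose levels are normalised by the Weyl element, e.g. the (T1) datum ★
`exists_cmIwahoriDatum`, `w ∈ K₀ = U(Φ₃)(𝒪_v)`) the normalised one-statement 2-step form ★ `Representation.smoothTrace_indicator_shell_eq_ite_of_normalizedTwoStep` (F1-G generic, ED. 2 — all of the above is done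
there, generically) gives,
for `b ∈ T` dominant at level `n` and `R` a left transversal of `K_n ∕ (K_n ∩ bK_nb⁻¹)`:
`tr ρ(𝟙_{K_n b K_n}; μ) = μ(K_n)·#R·(if χ|_{K_n ∩ T} = 1 then δ_B^{1/2}(b)·(χ(b) + (wχ)(b)) else 0)`.
* `forall_cmTorusCharPair_eq_one_iff_of_weylConj_mem` (ED. 2) — the `hiff` DISCHARGER: if a subgroup `K` is stable under conjugation by an element `w₀` with
  matrix `Φ₃` (e.g. the levels `K_n` of the (T1) datum ★ `exists_cmIwahoriDatum`, normalised by `K₀ = U(Φ₃)(𝒪_v) ∋ w₀`), then `χ|_{K ∩ T} = 1 ↔ (wχ)|_{K ∩ T} = 1`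
  (★ `cmTorusCharPair_weylConj`: `χ(w₀ t w₀⁻¹) = (wχ)(t)`; `w₀² = 1` from `Φ₃² = 1` ★ `StdForm.over_mul_over`).
* **`smoothTrace_cmPrincipalSeries_indicator_shell_eq_ite`** — the corollary: ONE application of the generic ★ `smoothTrace_indicator_shell_eq_ite_of_normalizedTwoStep` to
  the Keys N1 datum ★ `n1_line_data` (admissibility ★ `isAdmissible_cmPrincipalSeries_of_iwasawa`, `B` closed ★ `isClosed_borelU`, `N` closed ★ `isClosed_cmBorelTriple_N`,
  `T` abelian ★ `torusU_mul_comm`); no rewriting on the CM carriers (cf. the ELABORATION NOTE of ★ `F0P3cStCharTSJacLen1`).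

## References
* [Casselman1977] W. Casselman, *Characters and Jacquet modules*, Math. Ann. 230 (1977), Thm. 5.2.
* [Casselman1995] W. Casselman, *Introduction to the theory of admissible representations of p-adic reductive groups* (1995 notes): Lemma 7.1.1 (a) p. 67, Thm. 3.3.3,
  Prop. 3.3.6, Prop. 4.1.6.
* [Rogawski1990] J. D. Rogawski, *Automorphic Representations of Unitary Groups in Three Variables*, Ann. of Math. Stud. 123 (1990): §12.1–12.2 pp. 171–174; §12.7 p. 193.
-/

set_option autoImplicit false
set_option linter.dupNamespace false

noncomputable section

open NumberField IsDedekindDomain MeasureTheory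
open scoped Matrix NNReal Pointwise
open Literature.NumberTheory Literature.NumberTheory.Automorphic Literature.NumberTheory.Automorphic.UnitaryGroup
open Literature.NumberTheory.Rogawski1990

namespace Summit.HodgeConjecture.HodgeConjecture.Cruxes.H413.F0P3cStCharTSShellTracePS

variable (L : Type) [Field L] [NumberField L] [IsCMField L] (v : HeightOneSpectrum (𝓞 ↥(maximalRealSubfield L)))

/-! ## The corollary: `tr i_G(χ)(𝟙_{K_n b K_n})` at every level -/

open scoped Classical in
set_option synthInstance.maxHeartbeats 400000 in
set_option maxHeartbeats 2000000 in
/-- **F1-G COROLLARY «R2d-ALL-LEVELS FOR `i_G(χ)`».**  At a finite place `v` of `L⁺` NON-SPLIT in `L`, for the principal series `ρ = i_G(χ₁, χ₂)` of `G = U(Φ₃)(L⁺_v)`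
(continuous `χ₁, χ₂`), an Iwahori datum `𝓘` of the Borel triple, a level `n` at which «`χ` is trivial on `K_n ∩ T` iff `wχ` is» (`hiff`; automatic when the Weyl
element normalises `K_n`), a torus element `b` dominant at level `n`, a left transversal `R` of `K_n ∕ (K_n ∩ bK_nb⁻¹)` and a left-invariant measure `μ` finite on
compacts:  `tr ρ(𝟙_{K_n b K_n}; μ) = μ(K_n) · #R · (if χ|_{K_n ∩ T} = 1 then δ_B^{1/2}(b)·(χ(b) + (wχ)(b)) else 0)`.
(★ F1-G generic ED. 2 `Representation.smoothTrace_indicator_shell_eq_ite_of_normalizedTwoStep` at the Keys N1 datum ★ `n1_line_data`; admissibility ★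
`isAdmissible_cmPrincipalSeries_of_iwasawa`; `B` closed ★ `isClosed_borelU`; `N` closed ★ `isClosed_cmBorelTriple_N`; `T` abelian ★ `torusU_mul_comm`.)
[cite: Casselman1977, Thm. 5.2] [cite: Casselman1995, Lemma 7.1.1 (a) p. 67, Thm. 3.3.3, Prop. 4.1.6] [cite: Rogawski1990, §12.2 pp. 173–174; §12.7 p. 193] -/
theorem smoothTrace_cmPrincipalSeries_indicator_shell_eq_ite (hns : ∀ w : PlacesOver L v, IsCMField.complexConj L • w.1 = w.1)
    [MeasurableSpace ↥(unitaryGroupOfForm (conjLocal L (IsCMField.complexConj L) v) (cmLocalForm L 3 v))]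
    [BorelSpace ↥(unitaryGroupOfForm (conjLocal L (IsCMField.complexConj L) v) (cmLocalForm L 3 v))]
    (μ : Measure ↥(unitaryGroupOfForm (conjLocal L (IsCMField.complexConj L) v) (cmLocalForm L 3 v))) [μ.IsMulLeftInvariant] [IsFiniteMeasureOnCompacts μ]
    (χ₁ : (LocalRing L v)ˣ →* ℂˣ) (χ₂ : ↥(normOneUnits (conjLocal L (IsCMField.complexConj L) v)) →* ℂˣ)
    (h₁ : Continuous (fun x => ((χ₁ x : ℂˣ) : ℂ))) (h₂ : Continuous (fun x => ((χ₂ x : ℂˣ) : ℂ)))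
    (𝓘 : (cmBorelTriple L 3 v).IwahoriDatum) (n : ℕ)
    (hiff : (∀ k : ↥(cmBorelTriple L 3 v).M, (k : ↥(unitaryGroupOfForm (conjLocal L (IsCMField.complexConj L) v) (cmLocalForm L 3 v))) ∈ 𝓘.K n →
        cmTorusCharPair L v χ₁ χ₂ k = 1) ↔
      (∀ k : ↥(cmBorelTriple L 3 v).M, (k : ↥(unitaryGroupOfForm (conjLocal L (IsCMField.complexConj L) v) (cmLocalForm L 3 v))) ∈ 𝓘.K n →
        cmWeylTorusCharPair L v χ₁ χ₂ k = 1))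
    {b : ↥(unitaryGroupOfForm (conjLocal L (IsCMField.complexConj L) v) (cmLocalForm L 3 v))} (hbM : b ∈ (cmBorelTriple L 3 v).M)
    (hbN : ∀ x ∈ 𝓘.K n ⊓ (cmBorelTriple L 3 v).N, b * x * b⁻¹ ∈ 𝓘.K n)
    (hbNbar : ∀ x ∈ 𝓘.K n ⊓ 𝓘.Nbar, b⁻¹ * x * b ∈ 𝓘.K n ⊓ 𝓘.Nbar)
    (hbexh : ∀ x ∈ (cmBorelTriple L 3 v).N, ∃ m : ℕ, ∀ m', m ≤ m' → b ^ m' * x * (b ^ m')⁻¹ ∈ 𝓘.K n)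
    {R : Finset ↥(unitaryGroupOfForm (conjLocal L (IsCMField.complexConj L) v) (cmLocalForm L 3 v))}
    (hR : IsLeftTransversal (𝓘.K n) (𝓘.K n ⊓ ConjAct.toConjAct b • 𝓘.K n) R) :
    haveI := locallyCompactSpace_cmBorelU L 3 v
    (cmPrincipalSeries L 3 v (cmTorusCharPair L v χ₁ χ₂)).smoothTrace μ
        ((DoubleCoset.doubleCoset b (𝓘.K n : Set ↥(unitaryGroupOfForm (conjLocal L (IsCMField.complexConj L) v) (cmLocalForm L 3 v))) (𝓘.K n)).indicator
          fun _ => (1 : ℂ)) =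
      (μ.real (𝓘.K n : Set ↥(unitaryGroupOfForm (conjLocal L (IsCMField.complexConj L) v) (cmLocalForm L 3 v))) : ℂ) * (R.card : ℂ) *
        (if (∀ k : ↥(cmBorelTriple L 3 v).M, (k : ↥(unitaryGroupOfForm (conjLocal L (IsCMField.complexConj L) v) (cmLocalForm L 3 v))) ∈ 𝓘.K n →
              cmTorusCharPair L v χ₁ χ₂ k = 1) then
          ((rootDeltaChar (cmBorelTriple L 3 v).P (Subgroup.inclusion (cmBorelTriple L 3 v).M_le ⟨b, hbM⟩) : ℂˣ) : ℂ) *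
            ((((cmTorusCharPair L v χ₁ χ₂) ⟨b, hbM⟩ : ℂˣ) : ℂ) + (((cmWeylTorusCharPair L v χ₁ χ₂) ⟨b, hbM⟩ : ℂˣ) : ℂ))
        else 0) := by
  haveI := locallyCompactSpace_cmBorelU L 3 v
  have hN1 := F0P3cStCharTSJacLen1.n1_line_data L v hns χ₁ χ₂ h₁ h₂
  rcases hN1 with ⟨hfd, h2, ℓ, hℓ1, hLn, hQn⟩
  exact Representation.smoothTrace_indicator_shell_eq_ite_of_normalizedTwoStep μ
    (isAdmissible_cmPrincipalSeries_of_iwasawa L 3 v (exists_borel_mul_mem_cmLocalIntegralLevel L 3 v) _) (cmBorelTriple L 3 v)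
    (isClosed_borelU (conjLocal L (IsCMField.complexConj L) v) (cmLocalForm L 3 v)) (isClosed_cmBorelTriple_N L v) 𝓘 n hfd h2 ℓ hℓ1
    (cmWeylTorusCharPair L v χ₁ χ₂) (cmTorusCharPair L v χ₁ χ₂) hLn hQn hiff hbM
    (fun m hm => congrArg Subtype.val (torusU_mul_comm _ _ ⟨m, hm⟩ ⟨b, hbM⟩)) hbN hbNbar hbexh hR

/-! ## (ED. 2) The `hiff` discharger: `χ|_{K ∩ T} = 1 ↔ (wχ)|_{K ∩ T} = 1` for `K` stable under the Weyl conjugation -/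

set_option synthInstance.maxHeartbeats 400000 in
set_option maxHeartbeats 2000000 in
/-- **`χ` IS TRIVIAL ON `K ∩ T` IFF `wχ` IS**, for every subgroup `K ≤ U(Φ₃)(L⁺_v)` stable under conjugation by an element `w₀` whose matrix is `Φ₃` (then
`w₀² = 1` by `Φ₃² = 1` ★ `StdForm.over_mul_over`, `w₀ T w₀⁻¹ = T` ★ `weylConj_mem_cmTorus`, and `χ(w₀ t w₀⁻¹) = (wχ)(t)` ★ `cmTorusCharPair_weylConj`).  Discharges the
hypothesis `hiff` of `smoothTrace_cmPrincipalSeries_indicator_shell_eq_ite` at every level of an Iwahori datum whose levels are normalised by `w₀` (e.g. the (T1) datum: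
`w₀ ∈ K₀ = U(Φ₃)(𝒪_v)`, ★ `exists_cmIwahoriDatum` clause «`∀ n, ∀ k ∈ K₀, ∀ κ ∈ 𝓘.K n, k⁻¹ κ k ∈ 𝓘.K n`» at `k = w₀⁻¹ = w₀`).
[cite: Rogawski1990, §1.10 p. 9; §12.2 p. 173] [cite: Casselman1995, Lemma 7.1.1 (a) p. 67] -/
theorem forall_cmTorusCharPair_eq_one_iff_of_weylConj_mem
    (K : Subgroup ↥(unitaryGroupOfForm (conjLocal L (IsCMField.complexConj L) v) (cmLocalForm L 3 v)))
    (w₀ : ↥(unitaryGroupOfForm (conjLocal L (IsCMField.complexConj L) v) (cmLocalForm L 3 v)))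
    (hw₀ : Units.val (w₀ : GL (Fin 3) (LocalRing L v)) = cmLocalForm L 3 v)
    (hK : ∀ κ ∈ K, w₀ * κ * w₀⁻¹ ∈ K)
    (χ₁ : (LocalRing L v)ˣ →* ℂˣ) (χ₂ : ↥(normOneUnits (conjLocal L (IsCMField.complexConj L) v)) →* ℂˣ) :
    (∀ k : ↥(cmBorelTriple L 3 v).M, (k : ↥(unitaryGroupOfForm (conjLocal L (IsCMField.complexConj L) v) (cmLocalForm L 3 v))) ∈ K →
        cmTorusCharPair L v χ₁ χ₂ k = 1) ↔
      (∀ k : ↥(cmBorelTriple L 3 v).M, (k : ↥(unitaryGroupOfForm (conjLocal L (IsCMField.complexConj L) v) (cmLocalForm L 3 v))) ∈ K →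
        cmWeylTorusCharPair L v χ₁ χ₂ k = 1) := by
  -- `w₀² = 1`, so `w₀⁻¹ = w₀`
  have hsq : w₀ * w₀ = 1 := by
    apply Subtype.ext
    apply Units.ext
    change Units.val (w₀ : GL (Fin 3) (LocalRing L v)) * Units.val (w₀ : GL (Fin 3) (LocalRing L v)) = 1
    rw [hw₀, cmLocalForm_eq_over, StdForm.over_mul_over]
  have hinv : w₀⁻¹ = w₀ := inv_eq_of_mul_eq_one_right hsq
  constructor
  · intro h t ht
    rw [← cmTorusCharPair_weylConj L v w₀ hw₀ χ₁ χ₂ t]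
    exact h ⟨_, weylConj_mem_cmTorus L v w₀ hw₀ t⟩ (hK _ ht)
  · intro h t ht
    -- `t' := w₀ t w₀⁻¹ ∈ K ∩ T` and `t = w₀ t' w₀⁻¹`
    have ht' : w₀ * (t : ↥(unitaryGroupOfForm (conjLocal L (IsCMField.complexConj L) v) (cmLocalForm L 3 v))) * w₀⁻¹ ∈ K := hK _ ht
    have key := cmTorusCharPair_weylConj L v w₀ hw₀ χ₁ χ₂ ⟨_, weylConj_mem_cmTorus L v w₀ hw₀ t⟩
    rw [h ⟨_, weylConj_mem_cmTorus L v w₀ hw₀ t⟩ ht'] at key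
    have heq : (⟨w₀ * ((⟨w₀ * (t : ↥(unitaryGroupOfForm (conjLocal L (IsCMField.complexConj L) v) (cmLocalForm L 3 v))) * w₀⁻¹,
          weylConj_mem_cmTorus L v w₀ hw₀ t⟩ : ↥(torusU (conjLocal L (IsCMField.complexConj L) v) (cmLocalForm L 3 v))) :
            ↥(unitaryGroupOfForm (conjLocal L (IsCMField.complexConj L) v) (cmLocalForm L 3 v))) * w₀⁻¹,
          weylConj_mem_cmTorus L v w₀ hw₀ ⟨_, weylConj_mem_cmTorus L v w₀ hw₀ t⟩⟩ :
            ↥(torusU (conjLocal L (IsCMField.complexConj L) v) (cmLocalForm L 3 v))) = t := by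
      apply Subtype.ext
      show w₀ * (w₀ * (t : ↥(unitaryGroupOfForm (conjLocal L (IsCMField.complexConj L) v) (cmLocalForm L 3 v))) * w₀⁻¹) * w₀⁻¹ = _
      rw [hinv]
      calc w₀ * (w₀ * (t : ↥(unitaryGroupOfForm (conjLocal L (IsCMField.complexConj L) v) (cmLocalForm L 3 v))) * w₀) * w₀
          = (w₀ * w₀) * (t : ↥(unitaryGroupOfForm (conjLocal L (IsCMField.complexConj L) v) (cmLocalForm L 3 v))) * (w₀ * w₀) := by
            simp only [mul_assoc]
        _ = _ := by rw [hsq, one_mul, mul_one]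
    rw [heq] at key
    exact key

end Summit.HodgeConjecture.HodgeConjecture.Cruxes.H413.F0P3cStCharTSShellTracePS

end
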